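import Summits.HubbardSuperconductivity.HubbardSuperconductivity.Theses.ThermalWedge
import Summits.HubbardSuperconductivity.HubbardSuperconductivity.Theorems.ThermalWedgeTwApproximatingHamiltonianGauge
import Summits.HubbardSuperconductivity.HubbardSuperconductivity.Theorems.ThermalWedgeTwApproximatingHamiltonianLocality

/-!
# Route `ThermalWedge` — support item `TwApproximatingHamiltonian` (stmt-HubbardSuperconductivity-1703)

The approximating-Hamiltonian theorem for the `d`-wave-seeded Hubbard torus at `T > 0`
(Bogoliubov Jr.–Brankov–Zagrebnov–Kurbatov–Tonchev 1984; Bru–de Siqueira Pedra, Mem. AMS 224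
(2013), Appendix, Theorem 107), obtained by INSTANTIATING the tree's proof of the attractive
one-channel theorem (`Literature/MathematicalPhysics/QuantumLattice/ApproximatingHamiltonianProofs.lean`):
with `T = hubbardTorusWith 2 L 1 U μ`, channel `W = √g·Δ_d` (`Δ_d = pairField dWaveFormFactor L`),
volume `V = L²` and amplitude `c = h/√g`,
* the easy half `p̃_L(h) − h²/g ≤ p_L(g)` (every `L`, every real `h`) is
  `log_partitionFn_approx_le_model` (completed square `V⁻¹(W − cV)ᴴ(W − cV) ≥ 0`);
* the hard half `p_L(g) ≤ p̃_L(h_L) − h_L²/g + ε` eventually in `L` is the quantitative bound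
  `exists_pressure_model_le`: its inputs are `‖W‖ ≤ C₁V` (`norm_pairField_le`), the volume-linear
  commutator bounds `‖[W,Wᴴ]‖ ≤ C₂V` and `‖[T,W]‖ = O(V)` of the locality helper file (graded
  locality, Bratteli–Robinson II §5.2.2), and the TRIVIAL bounds `‖[A,[B,C]]‖ ≤ 2‖A‖‖[B,C]‖` for
  the double commutators — their constants `C₃, C₄ = O(V)` enter the error only as `√(·V)/V`, so
  the error is `4rC₁ + M(r)/L → 0`; the complex amplitude `c` it produces is made real by the gauge
  rotation of the gauge helper file (`twAhm_partitionFn_approx_eq_dWaveSourceTorus`, `h = |c|√g`).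
-/

noncomputable section

namespace Summit.HubbardSuperconductivity.HubbardSuperconductivity.Theorems

open Literature.MathematicalPhysics.QuantumLattice Matrix Finset
open Literature.Probability.LatticeModels
open Summit.HubbardSuperconductivity.HubbardSuperconductivity.Theses.ThermalWedge
open scoped Matrix.Norms.L2Operator ComplexOrder

section Aux

variable {n : Type*} [Fintype n] [DecidableEq n]

/-- `‖[A, X]‖ ≤ 2‖A‖‖X‖` for the ring bracket. [folklore] -/
theorem twAhm_norm_lie_le (A X : Matrix n n ℂ) : ‖⁅A, X⁆‖ ≤ 2 * ‖A‖ * ‖X‖ := by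
  rw [Ring.lie_def]; exact norm_commutator_le A X

omit [Fintype n] [DecidableEq n] in
/-- A real multiple of a matrix has norm `|a|·‖X‖`. [folklore] -/
theorem twAhm_norm_real_smul [Fintype n] [DecidableEq n] (a : ℝ) (X : Matrix n n ℂ) :
    ‖(a : ℂ) • X‖ = |a| * ‖X‖ := by
  rw [norm_smul, Complex.norm_real, Real.norm_eq_abs]

/-- `√(A·V + B) ≤ √(A + B)·√V` for `V ≥ 1`, `A, B ≥ 0`. [folklore] -/
theorem twAhm_sqrt_affine_le {A B V : ℝ} (hA : 0 ≤ A) (hB : 0 ≤ B) (hV : 1 ≤ V) :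
    Real.sqrt (A * V + B) ≤ Real.sqrt (A + B) * Real.sqrt V := by
  rw [← Real.sqrt_mul (add_nonneg hA hB)]
  exact Real.sqrt_le_sqrt (by nlinarith)

end Aux

/-- The channel `W = a·Δ_d`: `Wᴴ W = a²·Δ_dᴴΔ_d`, and with `a = √g`, `V = L²` the model
Hamiltonian `T − V⁻¹WᴴW` is the route's seeded grand-canonical Hamiltonian. [folklore] -/
theorem twAhm_model_eq (L : ℕ) [NeZero L] (U μ : ℝ) {g : ℝ} (hg : 0 ≤ g) :
    hubbardTorusWith 2 L 1 U μ - ((((L : ℝ) ^ 2)⁻¹ : ℝ) : ℂ) •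
        ((((Real.sqrt g : ℝ) : ℂ) • pairField dWaveFormFactor L)ᴴ *
          (((Real.sqrt g : ℝ) : ℂ) • pairField dWaveFormFactor L)) =
      hubbardTorusWith 2 L 1 U μ - ((g / (L : ℝ) ^ 2 : ℝ) : ℂ) •
        ((pairField dWaveFormFactor L)ᴴ * pairField dWaveFormFactor L) := by
  rw [conjTranspose_smul, Complex.star_def, Complex.conj_ofReal, smul_mul_smul_comm, smul_smul]
  congr 2
  rw [← Complex.ofReal_mul, ← Complex.ofReal_mul, Real.mul_self_sqrt hg]
  push_cast
  ring

/-- With the REAL amplitude `c = h/√g` the approximating Hamiltonian is the route's sourced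
Hamiltonian `dWaveSourceTorus L U μ h`. [folklore] -/
theorem twAhm_approx_real_eq (L : ℕ) [NeZero L] (U μ h : ℝ) {g : ℝ} (hg : 0 < g) :
    hubbardTorusWith 2 L 1 U μ -
        (starRingEnd ℂ ((h / Real.sqrt g : ℝ) : ℂ) • (((Real.sqrt g : ℝ) : ℂ) • pairField dWaveFormFactor L) +
          ((h / Real.sqrt g : ℝ) : ℂ) • (((Real.sqrt g : ℝ) : ℂ) • pairField dWaveFormFactor L)ᴴ) =
      dWaveSourceTorus L U μ h := by
  have hsg : Real.sqrt g ≠ 0 := (Real.sqrt_pos.2 hg).ne'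
  have hsc : ((h / Real.sqrt g : ℝ) : ℂ) * ((Real.sqrt g : ℝ) : ℂ) = (h : ℂ) := by
    rw [← Complex.ofReal_mul, div_mul_cancel₀ h hsg]
  rw [Complex.conj_ofReal, conjTranspose_smul, Complex.star_def, Complex.conj_ofReal, smul_smul,
    smul_smul, hsc, ← smul_add, dWaveSourceTorus]

/-- **`TwApproximatingHamiltonian`** (stmt-HubbardSuperconductivity-1703): the approximating-
Hamiltonian theorem for the `d`-wave-seeded Hubbard torus, both halves, by instantiating the
tree's Bogoliubov Jr. estimates (`log_partitionFn_approx_le_model`, `exists_pressure_model_le`)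
at `W = √g·Δ_d`, `V = L²`, with the locality bounds of the helper files and the gauge rotation
making the amplitude real. Bogolyubov Jr. et al. (1984); Bru–de Siqueira Pedra (2013) Thm 107. -/
theorem twApproximatingHamiltonian_proof : TwApproximatingHamiltonian := by
  intro U μ β g hβ hg
  have hT : ∀ (L : ℕ), (hubbardTorusWith 2 L 1 U μ).IsHermitian := fun L =>
    isHermitian_hubbardTorusWith L 1 U μ
  have hsg : 0 < Real.sqrt g := Real.sqrt_pos.2 hg
  constructor
  · -- the easy half: every `L`, every real source `h`
    intro L _ h
    have hL : (0 : ℝ) < (L : ℝ) := by exact_mod_cast NeZero.pos L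
    have hV : (0 : ℝ) < (L : ℝ) ^ 2 := by positivity
    have key := log_partitionFn_approx_le_model (hT L)
      (((Real.sqrt g : ℝ) : ℂ) • pairField dWaveFormFactor L) hβ.le hV ((h / Real.sqrt g : ℝ) : ℂ)
    rw [twAhm_approx_real_eq L U μ h hg, twAhm_model_eq L U μ hg.le, Complex.norm_real,
      Real.norm_eq_abs, sq_abs, div_pow, Real.sq_sqrt hg.le] at key
    have hβV : 0 < β * (L : ℝ) ^ 2 := mul_pos hβ hV
    have hdiv := div_le_div_of_nonneg_right key hβV.le
    rw [sub_div, show β * (L : ℝ) ^ 2 * (h ^ 2 / g) / (β * (L : ℝ) ^ 2) = h ^ 2 / g by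
      field_simp] at hdiv
    exact hdiv
  · -- the hard half: eventually in `L`, some real source
    intro ε hε
    -- `L`-independent constants (kept opaque: `positivity` must not unfold the Finset sums)
    obtain ⟨pd, hpd⟩ : ∃ pd : ℝ,
        pd = 2 * ∑ e ∈ insert (0 : Site 2) unitSteps, |dWaveFormFactor e / Real.sqrt 2| := ⟨_, rfl⟩
    have hpd0 : 0 ≤ pd := by rw [hpd]; positivity
    obtain ⟨a, ha⟩ : ∃ a : ℝ, a = Real.sqrt g := ⟨_, rfl⟩
    have ha0 : 0 < a := by rw [ha]; exact hsg
    obtain ⟨C₁, hC₁⟩ : ∃ C₁ : ℝ, C₁ = a * pd := ⟨_, rfl⟩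
    have hC₁0 : 0 ≤ C₁ := by rw [hC₁]; positivity
    obtain ⟨C₂, hC₂⟩ : ∃ C₂ : ℝ, C₂ = g * (25 * (2 * pd ^ 2)) := ⟨_, rfl⟩
    have hC₂0 : 0 ≤ C₂ := by rw [hC₂]; positivity
    obtain ⟨κ₀, hκ₀⟩ : ∃ κ₀ : ℝ, κ₀ = 45 * (2 * (2 * |(1 : ℝ)| + |U| + 2 * |μ|) * pd) := ⟨_, rfl⟩
    have hκ₀0 : 0 ≤ κ₀ := by rw [hκ₀]; positivity
    obtain ⟨c₃, hc₃⟩ : ∃ c₃ : ℝ, c₃ = 2 * C₁ * C₂ := ⟨_, rfl⟩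
    obtain ⟨c₄, hc₄⟩ : ∃ c₄ : ℝ, c₄ = 2 * C₁ * (a * κ₀) := ⟨_, rfl⟩
    have hc₃0 : 0 ≤ c₃ := by rw [hc₃]; positivity
    have hc₄0 : 0 ≤ c₄ := by rw [hc₄]; positivity
    obtain ⟨r, hr⟩ : ∃ r : ℝ, r = ε / (8 * (C₁ + 1)) := ⟨_, rfl⟩
    have hr0 : 0 < r := by rw [hr]; positivity
    obtain ⟨A₁, hA₁⟩ : ∃ A₁ : ℝ, A₁ = C₁ * (c₄ + c₃ * C₁) / r := ⟨_, rfl⟩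
    obtain ⟨B₁, hB₁⟩ : ∃ B₁ : ℝ, B₁ = C₁ * (2 * (C₂ / 2) ^ 2) / r := ⟨_, rfl⟩
    obtain ⟨A₂, hA₂⟩ : ∃ A₂ : ℝ, A₂ = C₁ * (c₄ + C₁ * c₃) / r := ⟨_, rfl⟩
    have hA₁0 : 0 ≤ A₁ := by rw [hA₁]; positivity
    have hB₁0 : 0 ≤ B₁ := by rw [hB₁]; positivity
    have hA₂0 : 0 ≤ A₂ := by rw [hA₂]; positivity
    obtain ⟨M, hM⟩ : ∃ M : ℝ,
        M = C₂ / 2 + 2 * C₁ / (β * r) + (Real.sqrt (A₁ + B₁) + Real.sqrt (A₂ + 0)) / 2 :=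
      ⟨_, rfl⟩
    have hM0 : 0 ≤ M := by rw [hM]; positivity
    refine ⟨⌈2 * M / ε⌉₊ + 1, ?_⟩
    intro L _ hL
    have hLpos : (0 : ℝ) < (L : ℝ) := by exact_mod_cast NeZero.pos L
    have hL1 : (1 : ℝ) ≤ (L : ℝ) := by exact_mod_cast NeZero.pos L
    have hV : (0 : ℝ) < (L : ℝ) ^ 2 := by positivity
    have hV1 : (1 : ℝ) ≤ (L : ℝ) ^ 2 := by nlinarith
    have hLM : 2 * M / ε ≤ (L : ℝ) := by
      have h1 : (2 * M / ε : ℝ) ≤ (⌈2 * M / ε⌉₊ : ℝ) := Nat.le_ceil _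
      have h2 : ((⌈2 * M / ε⌉₊ + 1 : ℕ) : ℝ) ≤ (L : ℝ) := by exact_mod_cast hL
      push_cast at h2
      linarith
    -- the channel `W = a·Δ_d` and its bounds in the box of side `L`
    have hΔn : ‖pairField dWaveFormFactor L‖ ≤ pd * (L : ℝ) ^ 2 := by rw [hpd]; exact norm_pairField_le dWaveFormFactor L
    have hWn : ‖(((a : ℝ) : ℂ) • pairField dWaveFormFactor L)‖ = a * ‖pairField dWaveFormFactor L‖ := by rw [twAhm_norm_real_smul, abs_of_pos ha0]
    have hU : ‖(((a : ℝ) : ℂ) • pairField dWaveFormFactor L)‖ ≤ C₁ * (L : ℝ) ^ 2 := by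
      rw [hWn, hC₁, mul_assoc]
      exact mul_le_mul_of_nonneg_left hΔn ha0.le
    have hWH : ‖((((a : ℝ) : ℂ) • pairField dWaveFormFactor L))ᴴ‖ = ‖(((a : ℝ) : ℂ) • pairField dWaveFormFactor L)‖ := l2_opNorm_conjTranspose _
    have hWreal : ((((a : ℝ) : ℂ) • pairField dWaveFormFactor L))ᴴ = ((a : ℝ) : ℂ) • (pairField dWaveFormFactor L)ᴴ := by
      rw [conjTranspose_smul, Complex.star_def, Complex.conj_ofReal]
    have hcommW : (((a : ℝ) : ℂ) • pairField dWaveFormFactor L) * ((((a : ℝ) : ℂ) • pairField dWaveFormFactor L))ᴴ - ((((a : ℝ) : ℂ) • pairField dWaveFormFactor L))ᴴ * (((a : ℝ) : ℂ) • pairField dWaveFormFactor L) =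
        ((a * a : ℝ) : ℂ) • (pairField dWaveFormFactor L * (pairField dWaveFormFactor L)ᴴ - (pairField dWaveFormFactor L)ᴴ * pairField dWaveFormFactor L) := by
      rw [hWreal, smul_mul_smul_comm, smul_mul_smul_comm, ← smul_sub, Complex.ofReal_mul]
    have h2 : ‖(((a : ℝ) : ℂ) • pairField dWaveFormFactor L) * ((((a : ℝ) : ℂ) • pairField dWaveFormFactor L))ᴴ - ((((a : ℝ) : ℂ) • pairField dWaveFormFactor L))ᴴ * (((a : ℝ) : ℂ) • pairField dWaveFormFactor L)‖ ≤ (L : ℝ) ^ 2 * C₂ := by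
      rw [hcommW, twAhm_norm_real_smul, abs_of_pos (mul_pos ha0 ha0),
        show a * a = g by rw [ha]; exact Real.mul_self_sqrt hg.le, hC₂]
      have := twAhm_norm_comm_pairField_conjTranspose_le L dWaveFormFactor
      rw [← hpd] at this
      calc g * ‖pairField dWaveFormFactor L * (pairField dWaveFormFactor L)ᴴ - (pairField dWaveFormFactor L)ᴴ * pairField dWaveFormFactor L‖ ≤ g * (25 * (2 * pd ^ 2) * (L : ℝ) ^ 2) :=
            mul_le_mul_of_nonneg_left this hg.le
        _ = (L : ℝ) ^ 2 * (g * (25 * (2 * pd ^ 2))) := by ring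
    have h2' : ‖⁅((((a : ℝ) : ℂ) • pairField dWaveFormFactor L))ᴴ, (((a : ℝ) : ℂ) • pairField dWaveFormFactor L)⁆‖ ≤ (L : ℝ) ^ 2 * C₂ := by
      rw [Ring.lie_def, norm_sub_rev]; exact h2
    have h3a : ‖⁅(((a : ℝ) : ℂ) • pairField dWaveFormFactor L), ⁅((((a : ℝ) : ℂ) • pairField dWaveFormFactor L))ᴴ, (((a : ℝ) : ℂ) • pairField dWaveFormFactor L)⁆⁆‖ ≤ (L : ℝ) ^ 2 * (c₃ * (L : ℝ) ^ 2) := by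
      refine (twAhm_norm_lie_le _ _).trans ?_
      calc 2 * ‖(((a : ℝ) : ℂ) • pairField dWaveFormFactor L)‖ * ‖⁅((((a : ℝ) : ℂ) • pairField dWaveFormFactor L))ᴴ, (((a : ℝ) : ℂ) • pairField dWaveFormFactor L)⁆‖
          ≤ 2 * (C₁ * (L : ℝ) ^ 2) * ((L : ℝ) ^ 2 * C₂) :=
            mul_le_mul (mul_le_mul_of_nonneg_left hU (by norm_num)) h2' (norm_nonneg _)
              (by positivity)
        _ = (L : ℝ) ^ 2 * (c₃ * (L : ℝ) ^ 2) := by rw [hc₃]; ring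
    have h3b : ‖⁅((((a : ℝ) : ℂ) • pairField dWaveFormFactor L))ᴴ, ⁅((((a : ℝ) : ℂ) • pairField dWaveFormFactor L))ᴴ, (((a : ℝ) : ℂ) • pairField dWaveFormFactor L)⁆⁆‖ ≤ (L : ℝ) ^ 2 * (c₃ * (L : ℝ) ^ 2) := by
      refine (twAhm_norm_lie_le _ _).trans ?_
      rw [hWH]
      calc 2 * ‖(((a : ℝ) : ℂ) • pairField dWaveFormFactor L)‖ * ‖⁅((((a : ℝ) : ℂ) • pairField dWaveFormFactor L))ᴴ, (((a : ℝ) : ℂ) • pairField dWaveFormFactor L)⁆‖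
          ≤ 2 * (C₁ * (L : ℝ) ^ 2) * ((L : ℝ) ^ 2 * C₂) :=
            mul_le_mul (mul_le_mul_of_nonneg_left hU (by norm_num)) h2' (norm_nonneg _)
              (by positivity)
        _ = (L : ℝ) ^ 2 * (c₃ * (L : ℝ) ^ 2) := by rw [hc₃]; ring
    have hWK : ‖⁅(((a : ℝ) : ℂ) • pairField dWaveFormFactor L), hubbardTorusWith 2 L 1 U μ⁆‖ ≤ a * κ₀ * (L : ℝ) ^ 2 := by
      have hlie : ⁅(((a : ℝ) : ℂ) • pairField dWaveFormFactor L), hubbardTorusWith 2 L 1 U μ⁆ = ((a : ℝ) : ℂ) • (pairField dWaveFormFactor L * hubbardTorusWith 2 L 1 U μ - hubbardTorusWith 2 L 1 U μ * pairField dWaveFormFactor L) := by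
        rw [Ring.lie_def, Matrix.smul_mul, Matrix.mul_smul, smul_sub]
      rw [hlie, twAhm_norm_real_smul, abs_of_pos ha0, norm_sub_rev, mul_assoc]
      refine mul_le_mul_of_nonneg_left ?_ ha0.le
      have := twAhm_norm_comm_hubbardTorusWith_pairField_le L 1 U μ dWaveFormFactor
      rw [← hpd] at this
      rw [hκ₀]
      convert this using 1
    have h4a : ‖⁅(((a : ℝ) : ℂ) • pairField dWaveFormFactor L), ⁅(((a : ℝ) : ℂ) • pairField dWaveFormFactor L), hubbardTorusWith 2 L 1 U μ⁆⁆‖ ≤ (L : ℝ) ^ 2 * (c₄ * (L : ℝ) ^ 2) := by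
      refine (twAhm_norm_lie_le _ _).trans ?_
      calc 2 * ‖(((a : ℝ) : ℂ) • pairField dWaveFormFactor L)‖ * ‖⁅(((a : ℝ) : ℂ) • pairField dWaveFormFactor L), hubbardTorusWith 2 L 1 U μ⁆‖
          ≤ 2 * (C₁ * (L : ℝ) ^ 2) * (a * κ₀ * (L : ℝ) ^ 2) :=
            mul_le_mul (mul_le_mul_of_nonneg_left hU (by norm_num)) hWK (norm_nonneg _)
              (by positivity)
        _ = (L : ℝ) ^ 2 * (c₄ * (L : ℝ) ^ 2) := by rw [hc₄]; ring
    have h4b : ‖⁅((((a : ℝ) : ℂ) • pairField dWaveFormFactor L))ᴴ, ⁅(((a : ℝ) : ℂ) • pairField dWaveFormFactor L), hubbardTorusWith 2 L 1 U μ⁆⁆‖ ≤ (L : ℝ) ^ 2 * (c₄ * (L : ℝ) ^ 2) := by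
      refine (twAhm_norm_lie_le _ _).trans ?_
      rw [hWH]
      calc 2 * ‖(((a : ℝ) : ℂ) • pairField dWaveFormFactor L)‖ * ‖⁅(((a : ℝ) : ℂ) • pairField dWaveFormFactor L), hubbardTorusWith 2 L 1 U μ⁆‖
          ≤ 2 * (C₁ * (L : ℝ) ^ 2) * (a * κ₀ * (L : ℝ) ^ 2) :=
            mul_le_mul (mul_le_mul_of_nonneg_left hU (by norm_num)) hWK (norm_nonneg _)
              (by positivity)
        _ = (L : ℝ) ^ 2 * (c₄ * (L : ℝ) ^ 2) := by rw [hc₄]; ring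
    -- Bogoliubov Jr.'s estimate in the box of side `L`
    obtain ⟨c, hc⟩ := exists_pressure_model_le (hT L) ((((a : ℝ) : ℂ) • pairField dWaveFormFactor L)) hβ hV hr0 hU h2 h3a h3b h4a h4b
    clear hU h2 h2' h3a h3b h4a h4b hWK hcommW hWreal hWH hWn hΔn
    -- the error is at most `ε`
    have h4r : 4 * r * C₁ ≤ ε / 2 := by
      rw [hr, show 4 * (ε / (8 * (C₁ + 1))) * C₁ = ε / 2 * (C₁ / (C₁ + 1)) by field_simp; ring]
      have hC1 : 0 < C₁ + 1 := by linarith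
      have h1 : C₁ / (C₁ + 1) ≤ 1 := (div_le_one hC1).2 (by linarith)
      have hε2 : 0 ≤ ε / 2 := by linarith
      calc ε / 2 * (C₁ / (C₁ + 1)) ≤ ε / 2 * 1 := mul_le_mul_of_nonneg_left h1 hε2
        _ = ε / 2 := mul_one _
    have hrad1 : C₁ * (c₄ * (L : ℝ) ^ 2 + 2 * (c₃ * (L : ℝ) ^ 2 / 2) * C₁ + 2 * (C₂ / 2) ^ 2) / r =
        A₁ * (L : ℝ) ^ 2 + B₁ := by
      rw [hA₁, hB₁]; field_simp
    have hrad2 : C₁ * (c₄ * (L : ℝ) ^ 2 + 2 * C₁ * (c₃ * (L : ℝ) ^ 2 / 2)) / r =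
        A₂ * (L : ℝ) ^ 2 + 0 := by
      rw [hA₂]; field_simp; ring
    have hsqL : Real.sqrt ((L : ℝ) ^ 2) = (L : ℝ) := Real.sqrt_sq hLpos.le
    have hs1 : Real.sqrt (C₁ * (c₄ * (L : ℝ) ^ 2 + 2 * (c₃ * (L : ℝ) ^ 2 / 2) * C₁ +
        2 * (C₂ / 2) ^ 2) / r) ≤ Real.sqrt (A₁ + B₁) * (L : ℝ) := by
      rw [hrad1]
      calc Real.sqrt (A₁ * (L : ℝ) ^ 2 + B₁) ≤ Real.sqrt (A₁ + B₁) * Real.sqrt ((L : ℝ) ^ 2) :=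
            twAhm_sqrt_affine_le hA₁0 hB₁0 hV1
        _ = Real.sqrt (A₁ + B₁) * (L : ℝ) := by rw [hsqL]
    have hs2 : Real.sqrt (C₁ * (c₄ * (L : ℝ) ^ 2 + 2 * C₁ * (c₃ * (L : ℝ) ^ 2 / 2)) / r) ≤
        Real.sqrt (A₂ + 0) * (L : ℝ) := by
      rw [hrad2]
      calc Real.sqrt (A₂ * (L : ℝ) ^ 2 + 0) ≤ Real.sqrt (A₂ + 0) * Real.sqrt ((L : ℝ) ^ 2) :=
            twAhm_sqrt_affine_le hA₂0 le_rfl hV1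
        _ = Real.sqrt (A₂ + 0) * (L : ℝ) := by rw [hsqL]
    have hQ : (C₂ / 2 + 2 * C₁ / (β * r) +
        (Real.sqrt (C₁ * (c₄ * (L : ℝ) ^ 2 + 2 * (c₃ * (L : ℝ) ^ 2 / 2) * C₁ +
            2 * (C₂ / 2) ^ 2) / r) +
          Real.sqrt (C₁ * (c₄ * (L : ℝ) ^ 2 + 2 * C₁ * (c₃ * (L : ℝ) ^ 2 / 2)) / r)) / 2) /
        (L : ℝ) ^ 2 ≤ ε / 2 := by
      have hA0 : 0 ≤ C₂ / 2 + 2 * C₁ / (β * r) := by positivity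
      have e1 : C₂ / 2 + 2 * C₁ / (β * r) ≤ (C₂ / 2 + 2 * C₁ / (β * r)) * (L : ℝ) :=
        le_mul_of_one_le_right hA0 hL1
      have hnum : C₂ / 2 + 2 * C₁ / (β * r) +
          (Real.sqrt (C₁ * (c₄ * (L : ℝ) ^ 2 + 2 * (c₃ * (L : ℝ) ^ 2 / 2) * C₁ +
              2 * (C₂ / 2) ^ 2) / r) +
            Real.sqrt (C₁ * (c₄ * (L : ℝ) ^ 2 + 2 * C₁ * (c₃ * (L : ℝ) ^ 2 / 2)) / r)) / 2 ≤
          M * (L : ℝ) := by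
        rw [hM]
        linarith
      have hML : M * (L : ℝ) / (L : ℝ) ^ 2 = M / (L : ℝ) := by
        rw [pow_two, mul_div_mul_right _ _ hLpos.ne']
      have hMε : M / (L : ℝ) ≤ ε / 2 := by
        rw [div_le_iff₀ hLpos]
        have h1 := mul_le_mul_of_nonneg_left hLM (by positivity : (0 : ℝ) ≤ ε / 2)
        have h2 : ε / 2 * (2 * M / ε) = M := by field_simp
        linarith
      calc _ ≤ M * (L : ℝ) / (L : ℝ) ^ 2 := div_le_div_of_nonneg_right hnum hV.le
        _ = M / (L : ℝ) := hML
        _ ≤ ε / 2 := hMε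
    -- make the amplitude real and conclude
    refine ⟨‖c‖ * Real.sqrt g, ?_⟩
    rw [ha] at hc
    rw [twAhm_model_eq L U μ hg.le,
      twAhm_partitionFn_approx_eq_dWaveSourceTorus L β U μ (Real.sqrt g) c] at hc
    have hnorm : ‖c‖ ^ 2 = (‖c‖ * Real.sqrt g) ^ 2 / g := by
      rw [mul_pow, Real.sq_sqrt hg.le, mul_div_assoc, div_self hg.ne', mul_one]
    rw [hnorm] at hc
    have hadd := add_le_add h4r hQ
    rw [add_halves] at hadd
    linarith only [hc, hadd]

end Summit.HubbardSuperconductivity.HubbardSuperconductivity.Theorems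

end
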